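import Summits.NavierStokesRegularity.NavierStokesRegularity.Theorems.SoloSalvageZhai2014
import Literature.Analysis.FluidPDE.KatoMaximalTime
import Literature.Analysis.FluidPDE.KatoFarFieldBound
import Literature.Analysis.FluidPDE.KatoL3Uniqueness
import Literature.Analysis.FluidPDE.KatoLocalHolds
import Literature.Analysis.FluidPDE.NSKatoToClayHolds
import Literature.Analysis.FluidPDE.RusinSverakLeraySolutions
import Literature.Analysis.FluidPDE.NSLerayHopfSereginMild
import Literature.Analysis.FluidPDE.NSLerayHopfSereginEnergyProofs
import Literature.Analysis.FluidPDE.NSLerayExistenceR3Holds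
import Literature.Analysis.FluidPDE.VectorCalculus
import HarnessLib

/-!
# Solo salvage for claim C18 `Zhai2014`, part 2: the Clay bridge `LHBridge`, kernel-discharged —
# the row's link «Thm 1.1 ⇒ Fefferman (A)» is now unconditional

Continuation of `Theorems/SoloSalvageZhai2014.lean` (seat `ns-claims-salvage-p2`). The skeleton
`Literature/Claims/NS/Zhai2014.lean` composes `clay_of_claimed : leray_existence_R3 → LHBridge →
ClaimedTheorem → clayR3.Regularity` with the bookkeeping bridge `LHBridge` (NOT from the paper; Leray 1934
§33): for a Clay datum, a GLOBAL Leray–Hopf solution which is regular (a.e. equal to a smooth field) on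
every `ℝ³ × (0,T)` yields a Clay-(A)-sense solution for the datum. This file proves it from tree
engines, in the pattern of `typeICertificateLadder_noBlowupToClay_proof`:

* Kato maximal-time dichotomy for the datum (`katoMaximalTime`): if `T_max = ∞` the global Kato solution is
  the Clay solution (`clay_solution_of_hasGlobalKatoSolution_holds`) — the given weak solution is not even
  needed; if `T_max = T < ∞` the maximal Kato solution `w` has a singular point `(T, x₁)`
  (`lemarieRieusset_singular_point_of_blowup_holds`), `w = u` a.e. on `(0,T) × ℝ³` (weak–strong
  uniqueness through the bounded Tao-class solutions, `weak_strong_uniqueness_holds` +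
  `IsTaoSolutionOn.ae_eq_of_kato`), and `u` is a.e. a smooth — hence locally bounded — field near
  `(T, x₁)`: contradiction (`eLpNorm_parabolicCylinder_eq_top_of_ae_eq`).

* `lhBridge_holds : LHBridge`; `clay_of_claimed' : ClaimedTheorem → clayR3.Regularity` (both other
  inputs of `clay_of_claimed` being tree theorems: `leray_existence_R3_holds`).

WHAT THIS IS NOT: not a claim about NS regularity or blow-up; not a claim about any author beyond the
typed locator.
-/

noncomputable section

open Literature.Analysis.FluidPDE MeasureTheory Set Function Filter Topology Metric
open scoped ENNReal NNReal

-- The mandated landing namespace repeats the summit name by design (D-0017).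
set_option linter.dupNamespace false

namespace Summit.NavierStokesRegularity.NavierStokesRegularity.Theorems

namespace Zhai2014

open Literature.Claims.NS.Zhai2014 Literature.Claims.NS.ClayVariants

/-- **`LHBridge` HOLDS** (Leray 1934 §33 «comparaison des solutions turbulentes et régulières», in the
tree's Kato/Lemarié-Rieusset form): for a Clay datum `u₀` (smooth, divergence free, rapidly decaying),
`u₀ ∈ L²` is weakly divergence free, and every global Leray–Hopf solution from `u₀` (`ν = 1`, `f ≡ 0`)
which is regular on every `ℝ³ × (0,T)` gives a Clay-(A)-sense solution for `u₀`.
[cite: Leray1934, §33 with §§19–22] [cite: LemarieRieusset2016, Thm. 15.1 (C), Prop. 12.3] -/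
theorem lhBridge_holds : Literature.Claims.NS.Zhai2014.LHBridge := by
  intro u₀ hsm hdiv hdec
  classical
  have hν : (0 : ℝ) < 1 := one_pos
  -- the datum: `L²`, `L³`, weakly divergence free
  have hHk : ∀ n : ℕ, ∫⁻ x, ‖iteratedFDeriv ℝ n u₀ x‖ₑ ^ 2 < ⊤ :=
    hdec.lintegral_enorm_iteratedFDeriv_sq_lt_top
  have hmeas0 : AEStronglyMeasurable u₀ volume := hsm.continuous.aestronglyMeasurable
  have hL2 : ∫⁻ x, ‖u₀ x‖ₑ ^ 2 < ⊤ := by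
    refine lt_of_le_of_lt (le_of_eq (lintegral_congr fun x => ?_)) (hHk 0)
    rw [← ofReal_norm, ← ofReal_norm, norm_iteratedFDeriv_zero]
  have hu2 : MemLp u₀ 2 volume := ⟨hmeas0, eLpNorm_two_lt_top_of_lintegral_enorm_sq_lt_top hL2⟩
  obtain ⟨C₀, hC₀⟩ := hdec 0 0
  have hbd0 : ∀ x, ‖u₀ x‖ ≤ C₀ := fun x => by
    have h := hC₀ x
    rwa [pow_zero, one_mul, norm_iteratedFDeriv_zero] at h
  have hu3 : MemLp u₀ 3 volume := by
    refine ⟨hmeas0, ?_⟩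
    have h3 : eLpNorm u₀ 3 volume ^ 3 ≤ eLpNorm u₀ ⊤ volume * eLpNorm u₀ 2 volume ^ 2 :=
      eLpNorm_three_pow_le hmeas0
    have htop : eLpNorm u₀ ⊤ volume ≤ ENNReal.ofReal C₀ := eLpNorm_top_le_of_bound hbd0
    have hfin : eLpNorm u₀ ⊤ volume * eLpNorm u₀ 2 volume ^ 2 < ⊤ :=
      ENNReal.mul_lt_top (htop.trans_lt ENNReal.ofReal_lt_top)
        (ENNReal.pow_lt_top hu2.eLpNorm_lt_top)
    by_contra hnot
    rw [not_lt, top_le_iff] at hnot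
    rw [hnot, ENNReal.top_pow (by norm_num)] at h3
    exact absurd (h3.trans_lt hfin) (lt_irrefl _)
  have hdiv' : VectorCalculus.IsDivFree u₀ := fun x => hdiv x
  have hwdiv : IsWeaklyDivFree u₀ :=
    VectorCalculus.IsDivFree.isWeaklyDivFree_holds hdiv' (hsm.of_le (mod_cast le_top))
  refine ⟨hu2, hwdiv, fun u hLH hreg => ?_⟩
  -- the Kato maximal time of the datum
  by_cases htop : katoMaximalTime 1 u₀ = ⊤
  · exact clay_solution_of_hasGlobalKatoSolution_holds 1 hν u₀ hsm hdiv hdec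
      (hasGlobalKatoSolution_of_katoMaximalTime_eq_top kato_unique_holds hν htop)
  exfalso
  have hTm0 : 0 < katoMaximalTime 1 u₀ := katoMaximalTime_pos kato_local_holds hν hu3 hwdiv
  have htop' : katoMaximalTime 1 u₀ < ⊤ := lt_top_iff_ne_top.2 htop
  obtain ⟨w, hw⟩ := exists_isKatoSolutionOn_katoMaximalTime kato_unique_holds hν hTm0 htop'
  set T : ℝ := (katoMaximalTime 1 u₀).toReal with hT_def
  have hT0 : 0 < T := ENNReal.toReal_pos hTm0.ne' htop'.ne
  have hofReal : ENNReal.ofReal T = katoMaximalTime 1 u₀ := ENNReal.ofReal_toReal htop'.ne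
  have hmax : ∀ T'' : ℝ, T < T'' → ∀ w' : ℝ → EuclideanSpace ℝ (Fin 3) → EuclideanSpace ℝ (Fin 3),
      ¬ IsKatoSolutionOn T'' 1 u₀ w' :=
    fun T'' hT'' w' => not_isKatoSolutionOn_of_katoMaximalTime_lt (by
      rw [← hofReal]
      exact (ENNReal.ofReal_lt_ofReal_iff (hT0.trans hT'')).2 hT'')
  -- its singular point `(T, x₁)`
  obtain ⟨x₁, hx₁⟩ := lemarieRieusset_singular_point_of_blowup_holds hν hT0 hu3 hwdiv hw hmax
  have hall : ∀ r : ℝ, 0 < r →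
      eLpNorm (uncurry w) ⊤ (volume.restrict (parabolicCylinder r ((T : ℝ), x₁))) = ⊤ :=
    fun r hr => eLpNorm_top_parabolicCylinder_eq_top_of_small hT0 hx₁ hr
  -- weak–strong uniqueness: `u(t) = w(t)` a.e. for `0 < t < T` (through the Tao-class solutions)
  have hslice : ∀ t ∈ Ioo 0 T, u t =ᵐ[volume] w t := by
    intro t ht
    set S : ℝ := (t + T) / 2 with hS
    have htS : t < S := by rw [hS]; linarith [ht.2]
    have hST : S < T := by rw [hS]; linarith [ht.2]
    have hS0 : 0 < S := ht.1.trans htS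
    obtain ⟨uu, pp, huu⟩ := exists_isTaoSolutionOn_of_isKatoSolutionOn hν hsm hdiv hdec hw hS0 hST
    have hLHuu : IsLerayHopfOn S 1 0 u₀ uu := huu.isLerayHopfOn hS0
    obtain ⟨B, -, hB⟩ := huu.exists_bound_velocity
    have hSer : MemLqLp ⊤ ⊤ uu (Ioo 0 S) :=
      memLqLp_top_top_of_bound (fun s hs => huu.aestronglyMeasurable_slice hs) hB
    have h1 : u t =ᵐ[volume] uu t :=
      weak_strong_uniqueness_holds hν hS0 hLHuu (q := ⊤) (r := ⊤) ENNReal.ofNat_lt_top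
        (by simp [ENNReal.div_top]) hSer (hLH.isLerayHopfOn hS0) t ⟨ht.1, htS.le⟩
    have h2 : uu t =ᵐ[volume] w t :=
      huu.ae_eq_of_kato hν (hw.mild.mono (Ico_subset_Ico_right hST.le))
        (hw.continuousInLpOn.mono (Ico_subset_Ico_right hST.le))
        (hw.aestronglyMeasurable.mono_measure (Measure.restrict_mono
          (Set.prod_mono (Ioo_subset_Ioo_right hST.le) Subset.rfl) le_rfl)) t ⟨ht.1.le, htS⟩
    exact h1.trans h2
  have huw : uncurry u =ᵐ[volume.restrict (Ioo 0 T ×ˢ (univ : Set (EuclideanSpace ℝ (Fin 3))))]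
      uncurry w :=
    ae_restrict_prod_of_forall_ae_eq hslice (hLH.isLerayHopfOn hT0).weak.1 hw.aestronglyMeasurable
  -- the regular representative `v` of `u` on `(0, 2T)`
  obtain ⟨v, hvs, hveq⟩ := hreg (2 * T) (by positivity)
  have hvm : AEStronglyMeasurable (uncurry v) (volume.restrict (Ioo 0 T ×ˢ univ)) :=
    (hvs.continuousOn.mono (prod_mono (Ioo_subset_Ioo_right (by linarith)) Subset.rfl)).aestronglyMeasurable
      (measurableSet_Ioo.prod MeasurableSet.univ)
  have hvu : ∀ t ∈ Ioo 0 T, v t =ᵐ[volume] u t := fun t ht =>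
    (hveq t ⟨ht.1, ht.2.trans (by linarith)⟩).symm
  have hvw : uncurry v =ᵐ[volume.restrict (Ioo 0 T ×ˢ (univ : Set (EuclideanSpace ℝ (Fin 3))))]
      uncurry w :=
    (ae_restrict_prod_of_forall_ae_eq hvu hvm (hLH.isLerayHopfOn hT0).weak.1).trans huw
  -- `v` is bounded on the compact `[T/2, T] × B̄(x₁, 1) ⊆ (0, 2T) × ℝ³`
  set K : Set (ℝ × EuclideanSpace ℝ (Fin 3)) := Icc (T / 2) T ×ˢ closedBall x₁ 1 with hK_def
  have hK : IsCompact K := isCompact_Icc.prod (isCompact_closedBall _ _)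
  have hKsub : K ⊆ Ioo 0 (2 * T) ×ˢ (univ : Set (EuclideanSpace ℝ (Fin 3))) :=
    prod_mono (fun t ht => ⟨by linarith [ht.1], by linarith [ht.2]⟩) (subset_univ _)
  have hcont : ContinuousOn (uncurry v) K := hvs.continuousOn.mono hKsub
  obtain ⟨M, hM⟩ := hK.exists_bound_of_continuousOn hcont
  -- a small cylinder `Q_r(T, x₁) ⊆ K`
  set r : ℝ := min 1 (Real.sqrt (T / 2)) with hr_def
  have hr0 : 0 < r := lt_min one_pos (Real.sqrt_pos.2 (by positivity))
  have hr1 : r ≤ 1 := min_le_left _ _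
  have hr2 : r ^ 2 ≤ T / 2 := by
    calc r ^ 2 ≤ Real.sqrt (T / 2) ^ 2 := pow_le_pow_left₀ hr0.le (min_le_right _ _) 2
      _ = T / 2 := Real.sq_sqrt (by positivity)
  have hcylK : parabolicCylinder r ((T : ℝ), x₁) ⊆ K := by
    rintro ⟨s, y⟩ hz
    rw [mem_parabolicCylinder] at hz
    exact ⟨⟨by linarith [hz.1.1], hz.1.2.le⟩, mem_closedBall.2 (hz.2.le.trans hr1)⟩
  have hbdV : eLpNorm (uncurry v) ⊤ (volume.restrict (parabolicCylinder r ((T : ℝ), x₁))) < ⊤ := by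
    rw [eLpNorm_exponent_top]
    refine eLpNormEssSup_lt_top_of_ae_bound (C := M) ?_
    filter_upwards [ae_restrict_mem (isOpen_parabolicCylinder r ((T : ℝ), x₁)).measurableSet]
      with z hz
    exact hM _ (hcylK hz)
  -- … while the singularity of `w` at `(T, x₁)` transfers to `v`
  exact hbdV.ne (eLpNorm_parabolicCylinder_eq_top_of_ae_eq hT0 hvw x₁ hall hr0)

/-- **The row's Clay link, unconditional**: the claimed Thm 1.1 implies Fefferman's (A) — both other inputs
of the skeleton's `clay_of_claimed` are theorems (`leray_existence_R3_holds`, `lhBridge_holds`).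
[cite: FeffermanClay2006, (A) p. 2] -/
theorem clay_of_claimed' (h : Literature.Claims.NS.Zhai2014.ClaimedTheorem) :
    Literature.Claims.NS.ClayVariants.clayR3.Regularity :=
  clay_of_claimed leray_existence_R3_holds lhBridge_holds h

end Zhai2014

end Summit.NavierStokesRegularity.NavierStokesRegularity.Theorems
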